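import Mathlib.Algebra.MvPolynomial.SchwartzZippel
import Literature.ModelTheory.PseudofiniteFields.DefinablePredicates
import Literature.ModelTheory.PseudofiniteFields.GenericEtaleInterior
import Literature.ModelTheory.PseudofiniteFields.AlgebraicBoundedness
import Literature.ModelTheory.PseudofiniteFields.UniformBound
import Literature.ModelTheory.PseudofiniteFields.EtaleOpenTopology
import Literature.ModelTheory.PseudofiniteFields.DefinableExponentialSums
import HarnessLib

/-!
# No lonely generic point for definable translates over finite fields (from the étale-open facts)

Topic `Literature/ModelTheory/PseudofiniteFields`.  We PROVE, conditionally on three published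
named facts of this directory —

* `JohnsonTranWalsbergYe2024_thm71_psf` (Johnson–Tran–Walsberg–Ye 2024, Thm 7.1: over a
  pseudo-finite field no point of a positive-dimensional standard smooth locus is étale-isolated),
* `WalsbergYe2023_thmC_psf` (Walsberg–Ye 2023, Thm C (1)/D: a definable set in a pseudo-finite
  field is a finite union of points and étale-open subsets of standard smooth loci),
* `ChatzidakisVanDenDriesMacintyre1992_mainTheorem` (CDM 1992, Main Theorem; itself proved in the
  tree from their Prop. (2.7) and (3.3), `ChatzidakisVanDenDriesMacintyre1992_mainTheorem_holds_of`)

— the following **translate-recurrence ("no lonely generic point") theorem for definable sets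
over finite fields** (`noLonelyTranslate_of_facts`, and `noLonelyTranslate_of_facts_lc` with the
threshold on the characteristic): for ring formulas `τ(w; y)` and `α(v; y')` with `m` set
variables there are `K, Q ∈ ℕ` and `C₀ ∈ ℝ` such that for every finite field `F` with `|F| ≥ Q`
and every `y` there is an exceptional set `E ⊆ F^m`, `|E| ≤ C₀ |F|^{m−1}`, depending on `τ, y`
only, such that for every `y'`, writing `T = τ(F^m; y)`, `A = α(F^m; y')`: if `|A| > K` then every
`t ∈ T ∖ E` has `a₀ ≠ a` in `A` with `t + a − a₀ ∈ T`.

This is the qualitative core of the (unpublished, stronger, quantitative) named fact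
`DefinableTranslateRecurrenceLC` of this directory, and it is exactly the statement its consumers
use (Summits, route MatrixMultiplication/DefinableSTPPDichotomy: `stub_shadowBound_of_noLonely`,
`noLonely_of_definableTranslateRecurrenceLC`); here it rests on published theorems only.

## Proof

1. In a PSEUDO-FINITE field `K` (`noLonelySem_psf`): decompose `T = τ(K^m; y)` by Walsberg–Ye;
   off a non-zero polynomial `D_T` every point of `T` is étale-interior
   (`GenericEtaleInterior.lean`); `|A| > C(α)` makes `A = α(K^m; y')` infinite (algebraic
   boundedness, `ChatzidakisVanDenDriesMacintyre1992_mainTheorem.infinite_of_injective`), so some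
   Walsberg–Ye piece of `A` is étale-open in a positive-dimensional locus; translating an étale
   neighbourhood `O ⊆ T` of `t` to a point `a₀` of that piece, Thm 7.1 yields a second point `a`
   of the piece in it: `a ∈ A`, `a ≠ a₀`, `t + a − a₀ ∈ O ⊆ T` (`exists_ne_zero_forall_translate_mem`).
2. The conclusion "∃ a non-zero polynomial of multi-degree `≤ N` off which …" is ONE ring formula
   `θ_{C,N}(y)` (`exists_noLonelyFormula`, by the toolkit `DefinablePredicates.lean`; the
   polynomial enters through its box of coefficients, `exists_box_of_ne_zero`), true at every `y`
   of every pseudo-finite field for SOME `N`; compactness (`exists_uniform_bound_of_pseudoFinite`)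
   makes `N` uniform and transfer (`FiniteField.eventually_realize_forall_of_pseudoFinite`) moves
   `⋁_{n ≤ N} θ_{C,n}` to all finite fields with `|F| ≥ q₀`.
3. In the finite field, `E := {w | box polynomial = 0}` has `|E| ≤ mN |F|^{m−1}` by
   Schwartz–Zippel (`card_filter_boxSum_eq_zero_le`), and `K := C(α)`.

The case `m = 0` is vacuous (`|A| ≤ 1`).  The argument follows the crux-17883 refutation file
of the Summits tree (`PairwiseCurvedTilingsLCFalseOfEtaleOpenFacts.lean`), freed of the STPP
family; nothing route-specific remains.

## References

* [JohnsonTranWalsbergYe2024] W. Johnson, C.-M. Tran, E. Walsberg, J. Ye, The étale-open topology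
  and the stable fields conjecture, J. Eur. Math. Soc. 26 (2024) 4033–4070, Thm 7.1, Thm A.
* [WalsbergYe2023] E. Walsberg, J. Ye, Éz fields, J. Algebra 614 (2023) 611–649, Thm C (1), Thm D.
* [ChatzidakisVanDenDriesMacintyre1992] Z. Chatzidakis, L. van den Dries, A. Macintyre, Definable
  sets over finite fields, J. reine angew. Math. 427 (1992) 107–135, Main Theorem, (2.7).
-/

namespace Literature.ModelTheory.PseudofiniteFields

open FirstOrder FirstOrder.Language FirstOrder.Ring MvPolynomial

/-! ## The box polynomial `Σ_β d_β X^β` of multi-degree `≤ N` -/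

section Box

variable {K : Type*} [Field K] {m N : ℕ}

/-- The box sum `Σ_β d_β ∏_l w_l^{β_l}` is the evaluation at `w` of the box polynomial
`Σ_β d_β · X^β`. [folklore] -/
theorem boxSum_eq_eval_boxPoly (d : (Fin m → Fin (N + 1)) → K) (w : Fin m → K) :
    ∑ β : Fin m → Fin (N + 1), d β * ∏ l : Fin m, w l ^ ((β l : ℕ)) =
      eval w (∑ β : Fin m → Fin (N + 1),
        monomial (Finsupp.equivFunOnFinite.symm fun l => ((β l : ℕ))) (d β)) := by
  rw [map_sum]
  refine Finset.sum_congr rfl fun β _ => ?_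
  rw [eval_monomial]
  congr 1
  rw [Finsupp.prod_fintype]
  · rfl
  · intro i; rw [pow_zero]

/-- The box polynomial of a non-zero coefficient function is non-zero: the exponent map
`β ↦ (l ↦ β_l)` is injective on the box, so the coefficient of `X^β` is `d_β`. [folklore] -/
theorem boxPoly_ne_zero {d : (Fin m → Fin (N + 1)) → K} (hd : d ≠ 0) :
    (∑ β : Fin m → Fin (N + 1),
        monomial (Finsupp.equivFunOnFinite.symm fun l => ((β l : ℕ))) (d β)) ≠ 0 := by
  classical
  obtain ⟨β₀, hβ₀⟩ := Function.ne_iff.1 hd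
  intro h0
  apply hβ₀
  have hc := congrArg (coeff (Finsupp.equivFunOnFinite.symm fun l => ((β₀ l : ℕ)))) h0
  rw [coeff_sum, coeff_zero, Finset.sum_eq_single β₀] at hc
  · rwa [coeff_monomial, if_pos rfl] at hc
  · intro β _ hne
    rw [coeff_monomial, if_neg]
    intro heq
    apply hne
    funext l
    have hl := congrArg (fun f : Fin m →₀ ℕ => f l) heq
    simp only [Finsupp.coe_equivFunOnFinite_symm] at hl
    exact Fin.ext hl
  · intro hβ; exact absurd (Finset.mem_univ _) hβ

/-- The box polynomial with exponents `≤ N` in each of the `m` variables has total degree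
`≤ m N`. [folklore] -/
theorem totalDegree_boxPoly_le (d : (Fin m → Fin (N + 1)) → K) :
    (∑ β : Fin m → Fin (N + 1),
        monomial (Finsupp.equivFunOnFinite.symm fun l => ((β l : ℕ))) (d β)).totalDegree
      ≤ m * N := by
  refine totalDegree_finsetSum_le fun β _ => ?_
  refine (totalDegree_monomial_le _ _).trans ?_
  rw [Finsupp.sum_fintype _ _ (fun _ => rfl)]
  calc ∑ l : Fin m, id ((Finsupp.equivFunOnFinite.symm fun l => ((β l : ℕ))) l)
      ≤ ∑ _l : Fin m, N := Finset.sum_le_sum fun l _ => by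
          rw [Finsupp.coe_equivFunOnFinite_symm]; exact Nat.lt_succ_iff.1 (β l).2
    _ = m * N := by rw [Finset.sum_const, Finset.card_univ, Fintype.card_fin, smul_eq_mul]

/-- **Coefficient extraction**: a non-zero polynomial of total degree `≤ N` is the box polynomial
of a non-zero coefficient function on the box of exponents `≤ N`, with the same evaluations.
[folklore] -/
theorem exists_box_of_ne_zero (D : MvPolynomial (Fin m) K) (hD : D ≠ 0) (hN : D.totalDegree ≤ N) :
    ∃ d : (Fin m → Fin (N + 1)) → K, d ≠ 0 ∧
      ∀ w : Fin m → K, ∑ β : Fin m → Fin (N + 1), d β * ∏ l : Fin m, w l ^ ((β l : ℕ)) =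
        eval w D := by
  classical
  -- the exponent map from the box to finitely supported functions, injective
  let toF : (Fin m → Fin (N + 1)) → (Fin m →₀ ℕ) :=
    fun β => Finsupp.equivFunOnFinite.symm fun l => ((β l : ℕ))
  have htoF_inj : Function.Injective toF := by
    intro β β' h
    funext l
    have := congrArg (fun f : Fin m →₀ ℕ => f l) h
    simp only [toF, Finsupp.coe_equivFunOnFinite_symm] at this
    exact Fin.ext this
  -- every monomial of `D` has all exponents `≤ N`
  have hexp : ∀ s ∈ D.support, ∀ l, s l ≤ N := by
    intro s hs l
    have h1 : s l ≤ s.sum fun _ e => e := by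
      by_cases hl : l ∈ s.support
      · exact Finset.single_le_sum (fun _ _ => Nat.zero_le _) hl
      · rw [Finsupp.notMem_support_iff.1 hl]; exact Nat.zero_le _
    have h2 : (s.sum fun _ e => e) ≤ D.totalDegree := le_totalDegree hs
    omega
  have hsupp : ∀ s ∈ D.support, ∃ β : Fin m → Fin (N + 1), toF β = s := by
    intro s hs
    refine ⟨fun l => ⟨s l, Nat.lt_succ_of_le (hexp s hs l)⟩, ?_⟩
    ext l; simp [toF]
  refine ⟨fun β => D.coeff (toF β), ?_, fun w => ?_⟩
  · -- non-zero: some monomial of the support lies in the box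
    obtain ⟨s, hs⟩ := ne_zero_iff.1 hD
    obtain ⟨β, hβ⟩ := hsupp s (mem_support_iff.2 hs)
    intro hzero
    have := congrFun hzero β
    rw [Pi.zero_apply, hβ] at this
    exact hs this
  · rw [boxSum_eq_eval_boxPoly]
    congr 1
    symm
    conv_lhs => rw [D.as_sum]
    rw [← Finset.sum_image (f := fun s => monomial s (D.coeff s)) (fun β _ β' _ h => htoF_inj h)]
    apply Finset.sum_subset
    · intro s hs
      obtain ⟨β, rfl⟩ := hsupp s hs
      exact Finset.mem_image.2 ⟨β, Finset.mem_univ _, rfl⟩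
    · intro s _ hs
      rw [notMem_support_iff.1 hs, map_zero]

/-- **Schwartz–Zippel for the box polynomial, counting form**: in a finite field, a NON-ZERO box
function `d` (exponents `≤ N` in each of `m` variables, so total degree `≤ mN`) vanishes on at most
`mN |F|^{m−1}` points of `F^m`. [folklore] -/
theorem card_filter_boxSum_eq_zero_le {F : Type*} [Field F] [Fintype F] [DecidableEq F] {m N : ℕ}
    (d : (Fin m → Fin (N + 1)) → F) (hd : d ≠ 0) :
    ((Finset.univ.filter fun w : Fin m → F =>
        ∑ β : Fin m → Fin (N + 1), d β * ∏ l : Fin m, w l ^ ((β l : ℕ)) = 0).card : ℝ) ≤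
      ((m * N : ℕ) : ℝ) * (Fintype.card F : ℝ) ^ ((m : ℝ) - 1) := by
  set P : MvPolynomial (Fin m) F := ∑ β : Fin m → Fin (N + 1),
    monomial (Finsupp.equivFunOnFinite.symm fun l => ((β l : ℕ))) (d β) with hP
  have hP0 : P ≠ 0 := boxPoly_ne_zero hd
  have hdeg : P.totalDegree ≤ m * N := totalDegree_boxPoly_le d
  have hset : (Finset.univ.filter fun w : Fin m → F =>
      ∑ β : Fin m → Fin (N + 1), d β * ∏ l : Fin m, w l ^ ((β l : ℕ)) = 0) =
      Finset.univ.filter fun w : Fin m → F => eval w P = 0 := by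
    refine Finset.filter_congr fun w _ => ?_
    rw [hP, ← boxSum_eq_eval_boxPoly]
  -- Schwartz–Zippel (Mathlib), counting form `#Z · |F| ≤ deg P · |F|^m`
  have hsz := MvPolynomial.schwartz_zippel_totalDegree hP0 (Finset.univ : Finset F)
  rw [Fintype.piFinset_univ, Finset.card_univ] at hsz
  have hF : (0 : ℚ≥0) < Fintype.card F := by exact_mod_cast Fintype.card_pos
  have hFm : (0 : ℚ≥0) < (Fintype.card F : ℚ≥0) ^ m := pow_pos hF m
  rw [div_le_div_iff₀ hFm hF] at hsz
  have hnat : (Finset.univ.filter fun w : Fin m → F => eval w P = 0).card * Fintype.card F ≤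
      m * N * Fintype.card F ^ m := by
    have h1 : (Finset.univ.filter fun w : Fin m → F => eval w P = 0).card * Fintype.card F ≤
        P.totalDegree * Fintype.card F ^ m := by exact_mod_cast hsz
    exact h1.trans (Nat.mul_le_mul_right _ hdeg)
  rw [hset]
  have hq : (0 : ℝ) < (Fintype.card F : ℝ) := by exact_mod_cast Fintype.card_pos
  rw [Real.rpow_sub_one hq.ne', Real.rpow_natCast, ← mul_div_assoc, le_div_iff₀ hq]
  exact_mod_cast hnat

end Box

/-! ## The first-order encoding -/

/-- **The encoding formula `θ_{C,N}(y)`.**  For ring formulas `τ(w; y)`, `α(v; y')` and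
`C N : ℕ`, ONE ring formula in `y` expresses, uniformly in the field: "there is a non-zero box
function `d` (exponents `≤ N`) such that every `t ∈ τ(·; y)` with `Σ_β d_β t^β ≠ 0` has, for every
`y'` for which `α(·; y')` has `C + 1` pairwise distinct points, some `a₀, a ∈ α(·; y')`, `a ≠ a₀`,
with `t + a − a₀ ∈ τ(·; y)`".  Structural, by `DefinablePredicates.lean`. [folklore] -/
theorem exists_noLonelyFormula (m n n' C N : ℕ) (τ : Language.ring.Formula (Fin m ⊕ Fin n))
    (α : Language.ring.Formula (Fin m ⊕ Fin n')) :
    ∃ θ : Language.ring.Formula (Fin n), ∀ (K : Type) [Field K] [CompatibleRing K]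
      (y : Fin n → K), θ.Realize y ↔
        ∃ d : (Fin m → Fin (N + 1)) → K, d ≠ 0 ∧
          ∀ t : Fin m → K, τ.Realize (Sum.elim t y) →
            ∑ β : Fin m → Fin (N + 1), d β * ∏ l : Fin m, t l ^ ((β l : ℕ)) ≠ 0 →
            ∀ y' : Fin n' → K,
              (∃ w : Fin (C + 1) → Fin m → K, Function.Injective w ∧
                  ∀ j, α.Realize (Sum.elim (w j) y')) →
              ∃ a₀ : Fin m → K, ∃ a : Fin m → K,
                α.Realize (Sum.elim a₀ y') ∧ α.Realize (Sum.elim a y') ∧ a ≠ a₀ ∧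
                  τ.Realize (Sum.elim (t + a - a₀) y) := by
  refine definable_exists ?_
  refine definable_and (definable_vecNeZero _) ?_
  refine definable_forall ?_
  refine definable_imp (definable_realize₂ τ _ _) ?_
  refine definable_imp (definable_boxSum_ne_zero m N _ _) ?_
  refine definable_forall ?_
  refine definable_imp ?_ ?_
  · refine definable_exists₂ ?_
    refine definable_and (definable_injective _) ?_
    exact definable_iInf fun j => definable_realize₂ α _ _
  refine definable_exists ?_
  refine definable_exists ?_
  exact definable_and (definable_realize₂ α _ _) (definable_and (definable_realize₂ α _ _)
    (definable_and (definable_vecNe _ _) (definable_realize₂_add_sub τ _ _ _ _)))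

/-! ## The statement in a pseudo-finite field -/

/-- **No lonely generic point, in a pseudo-finite field** (step 1 of the proof).  Let `K` be
pseudo-finite, `0 < m`, and assume JTWY Thm 7.1 and WY Thm C for pseudo-finite fields, and that
`C + 1` distinct points make `α(K^m; y')` infinite (`hC`, algebraic boundedness).  Then for every
`y` there are `N` and a non-zero box function `d` (the coefficients of the polynomial `D_T` off
which `T = τ(K^m; y)` is étale-open) witnessing `θ_{C,N}(y)`. [folklore] -/
theorem noLonelySem_psf (h71 : JohnsonTranWalsbergYe2024_thm71_psf) (hWY : WalsbergYe2023_thmC_psf)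
    {m n n' : ℕ} (hm : 0 < m) (τ : Language.ring.Formula (Fin m ⊕ Fin n))
    (α : Language.ring.Formula (Fin m ⊕ Fin n')) {C : ℕ}
    (hC : ∀ (K : Type) [Field K] [CompatibleRing K] [Infinite K], K ⊨ finiteFieldTheory →
      ∀ (y' : Fin n' → K) (w : Fin (C + 1) → (Fin m → K)), Function.Injective w →
        (∀ j, α.Realize (Sum.elim (w j) y')) →
          {x : Fin m → K | α.Realize (Sum.elim x y')}.Infinite)
    (K : Type) [Field K] [CompatibleRing K] [Infinite K] (hK : K ⊨ finiteFieldTheory)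
    (y : Fin n → K) :
    ∃ (N : ℕ) (d : (Fin m → Fin (N + 1)) → K), d ≠ 0 ∧
      ∀ t : Fin m → K, τ.Realize (Sum.elim t y) →
        ∑ β : Fin m → Fin (N + 1), d β * ∏ l : Fin m, t l ^ ((β l : ℕ)) ≠ 0 →
        ∀ y' : Fin n' → K,
          (∃ w : Fin (C + 1) → Fin m → K, Function.Injective w ∧
              ∀ j, α.Realize (Sum.elim (w j) y')) →
          ∃ a₀ : Fin m → K, ∃ a : Fin m → K,
            α.Realize (Sum.elim a₀ y') ∧ α.Realize (Sum.elim a y') ∧ a ≠ a₀ ∧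
              τ.Realize (Sum.elim (t + a - a₀) y) := by
  -- decompose `T = τ(K^m; y)` and take the polynomial off which translates recur
  obtain ⟨kT, cT, ST, XT, hTX, hXT⟩ := hWY K hK m n τ y
  obtain ⟨D, hD0, hD⟩ := exists_ne_zero_forall_translate_mem hm (h71 K hK m) ST XT hTX hXT
  obtain ⟨d, hd0, hdev⟩ := exists_box_of_ne_zero D hD0 le_rfl
  refine ⟨D.totalDegree, d, hd0, fun t ht hbox y' hw => ?_⟩
  obtain ⟨w, hw, hwα⟩ := hw
  have htD : eval t D ≠ 0 := by
    rw [← hdev t]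
    exact hbox
  -- `A = α(K^m; y')` is infinite and decomposed
  have hAinf : {x : Fin m → K | α.Realize (Sum.elim x y')}.Infinite := hC K hK y' w hw hwα
  obtain ⟨k, c, S, X, hAX, hX⟩ := hWY K hK m n' α y'
  obtain ⟨a₀, ha₀, a, ha, hne, hmem⟩ :=
    hD t ht htD {x | α.Realize (Sum.elim x y')} ⟨k, c, S, X, hAX, hX⟩ hAinf
  exact ⟨a₀, a, ha₀, ha, hne, hmem⟩

/-! ## The theorem over finite fields -/

/-- **No lonely generic point for definable translates over finite fields, from the étale-open
facts.**  Assume JTWY 2024 Thm 7.1 and WY 2023 Thm C (pseudo-finite special cases) and the CDM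
Main Theorem.  For ring formulas `τ(w; y)` (`w ∈ F^m`, `y ∈ F^n`) and `α(v; y')` (`v ∈ F^m`,
`y' ∈ F^{n'}`) there are `K, Q ∈ ℕ` and `C₀ ∈ ℝ` such that for every finite field `F` with
`Q ≤ |F|` (any compatible ring structure) and every `y` there is `E ⊆ F^m` with
`|E| ≤ C₀ |F|^{m−1}` (depending on `τ, y` only) such that for all `y'` and all `Finset`s
`T = τ(F^m; y)`, `A = α(F^m; y')`: if `K < |A|` then every `t ∈ T`, `t ∉ E`, has `a₀, a ∈ A`,
`a ≠ a₀`, with `t + a − a₀ ∈ T`.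
[cite: JohnsonTranWalsbergYe2024, Thm 7.1] [cite: WalsbergYe2023, Thm C (1) and Thm D]
[cite: ChatzidakisVanDenDriesMacintyre1992, Main Theorem and (2.7)] -/
theorem noLonelyTranslate_of_facts (h71 : JohnsonTranWalsbergYe2024_thm71_psf)
    (hWY : WalsbergYe2023_thmC_psf) (hCDM : ChatzidakisVanDenDriesMacintyre1992_mainTheorem)
    (m n n' : ℕ) (τ : Language.ring.Formula (Fin m ⊕ Fin n))
    (α : Language.ring.Formula (Fin m ⊕ Fin n')) :
    ∃ (K Q : ℕ) (C₀ : ℝ), ∀ (F : Type) [Field F] [Fintype F] [CompatibleRing F],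
      Q ≤ Fintype.card F → ∀ (y : Fin n → F), ∃ E : Finset (Fin m → F),
        (E.card : ℝ) ≤ C₀ * (Fintype.card F : ℝ) ^ ((m : ℝ) - 1) ∧
        ∀ (y' : Fin n' → F) (T A : Finset (Fin m → F)),
          (∀ w, w ∈ T ↔ τ.Realize (Sum.elim w y)) →
          (∀ v, v ∈ A ↔ α.Realize (Sum.elim v y')) →
          K < A.card → ∀ t ∈ T, t ∉ E → ∃ a₀ ∈ A, ∃ a ∈ A, a ≠ a₀ ∧ t + a - a₀ ∈ T := by
  classical
  rcases Nat.eq_zero_or_pos m with rfl | hm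
  · -- `m = 0`: `F^0` is one point, so `|A| ≤ 1` and the hypothesis `1 < |A|` never holds
    refine ⟨1, 0, 0, fun F _ _ _ _ y => ⟨∅, by simp, ?_⟩⟩
    intro y' T A _ _ hKA
    exfalso
    have hA1 : A.card ≤ 1 :=
      (Finset.card_le_univ A).trans (by rw [Fintype.card_fun, Fintype.card_fin, pow_zero])
    omega
  -- (1) algebraic boundedness constant of `α`
  obtain ⟨C, hC⟩ := hCDM.infinite_of_injective m n' α
  -- (2) the encoding formulas and their truth in pseudo-finite fields
  choose θ hθ using fun N => exists_noLonelyFormula m n n' C N τ α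
  have hpw : ∀ (K : Type) [Field K] [CompatibleRing K] [Infinite K], K ⊨ finiteFieldTheory →
      ∀ y : Fin n → K, ∃ N, (θ N).Realize y := by
    intro K _ _ _ hK y
    obtain ⟨N, hN⟩ := noLonelySem_psf h71 hWY hm τ α hC K hK y
    exact ⟨N, (hθ N K y).2 hN⟩
  -- (3) a uniform index and the transfer of `⋁_{k ≤ N₀} θ_k` to large finite fields
  obtain ⟨N₀, hN₀⟩ := FiniteField.exists_uniform_bound_of_pseudoFinite θ hpw
  set ψ : Language.ring.Formula (Fin n) := Formula.iSup fun k : Fin (N₀ + 1) => θ k with hψ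
  have hψK : ∀ (K : Type) [Field K] [CompatibleRing K] [Infinite K], K ⊨ finiteFieldTheory →
      ∀ y : Fin n → K, ψ.Realize y := by
    intro K _ _ _ hK y
    obtain ⟨k, hk, hreal⟩ := hN₀ K hK y
    rw [hψ, Formula.realize_iSup]
    exact ⟨⟨k, Nat.lt_succ_of_le hk⟩, hreal⟩
  obtain ⟨q₀, hq₀⟩ := FiniteField.eventually_realize_forall_of_pseudoFinite ψ hψK
  -- (4) the finite-field statement
  refine ⟨C, q₀, ((m * N₀ : ℕ) : ℝ), fun F _ _ instCR hcard y => ?_⟩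
  have hψF : ψ.Realize y := by
    rw [realize_iff_of_compatibleRing]
    exact hq₀ F hcard y
  rw [hψ, Formula.realize_iSup] at hψF
  obtain ⟨k, hk⟩ := hψF
  obtain ⟨d, hd0, hd⟩ := (hθ k F y).1 hk
  -- the exceptional set: the zeros of the box polynomial
  refine ⟨Finset.univ.filter fun w : Fin m → F =>
      ∑ β : Fin m → Fin (k + 1), d β * ∏ l : Fin m, w l ^ ((β l : ℕ)) = 0, ?_, ?_⟩
  · have hq0 : (0 : ℝ) ≤ (Fintype.card F : ℝ) ^ ((m : ℝ) - 1) := by positivity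
    calc _ ≤ ((m * (k : ℕ) : ℕ) : ℝ) * (Fintype.card F : ℝ) ^ ((m : ℝ) - 1) :=
          card_filter_boxSum_eq_zero_le d hd0
      _ ≤ ((m * N₀ : ℕ) : ℝ) * (Fintype.card F : ℝ) ^ ((m : ℝ) - 1) := by
          apply mul_le_mul_of_nonneg_right _ hq0
          exact_mod_cast Nat.mul_le_mul_left m (Nat.lt_succ_iff.1 k.2)
  · intro y' T A hT hA hKA t ht htE
    have hτt : τ.Realize (Sum.elim t y) := (hT t).1 ht
    have hbox : ∑ β : Fin m → Fin (k + 1), d β * ∏ l : Fin m, t l ^ ((β l : ℕ)) ≠ 0 :=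
      fun h0 => htE (Finset.mem_filter.2 ⟨Finset.mem_univ _, h0⟩)
    -- `C + 1` distinct points of `A`
    obtain ⟨w, hw⟩ : ∃ w : Fin (C + 1) ↪ (Fin m → F), ∀ j, w j ∈ A := by
      obtain ⟨s, hs, hscard⟩ := Finset.exists_subset_card_eq (Nat.succ_le_of_lt hKA)
      refine ⟨(Finset.equivFinOfCardEq hscard).symm.toEmbedding.trans
        (Function.Embedding.subtype _), fun j => hs ?_⟩
      exact Finset.coe_mem _
    obtain ⟨a₀, a, ha₀, ha, hne, hτ'⟩ :=
      hd t hτt hbox y' ⟨w, w.injective, fun j => (hA (w j)).1 (hw j)⟩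
    exact ⟨a₀, (hA a₀).2 ha₀, a, (hA a).2 ha, hne, (hT _).2 hτ'⟩

/-- **No lonely generic point, large-characteristic form** — verbatim the hypothesis of the
consumers of `DefinableTranslateRecurrenceLC` (threshold `Q ≤ ringChar F`, which implies
`Q ≤ |F|`).
[cite: JohnsonTranWalsbergYe2024, Thm 7.1] [cite: WalsbergYe2023, Thm C (1) and Thm D]
[cite: ChatzidakisVanDenDriesMacintyre1992, Main Theorem and (2.7)] -/
theorem noLonelyTranslate_of_facts_lc (h71 : JohnsonTranWalsbergYe2024_thm71_psf)
    (hWY : WalsbergYe2023_thmC_psf) (hCDM : ChatzidakisVanDenDriesMacintyre1992_mainTheorem) :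
    ∀ (m n n' : ℕ) (τ : Language.ring.Formula (Fin m ⊕ Fin n))
      (α : Language.ring.Formula (Fin m ⊕ Fin n')),
      ∃ (K Q : ℕ) (C₀ : ℝ), ∀ (F : Type) [Field F] [Fintype F] [CompatibleRing F],
        Q ≤ ringChar F → ∀ (y : Fin n → F), ∃ E : Finset (Fin m → F),
          (E.card : ℝ) ≤ C₀ * (Fintype.card F : ℝ) ^ ((m : ℝ) - 1) ∧
          ∀ (y' : Fin n' → F) (T A : Finset (Fin m → F)),
            (∀ w, w ∈ T ↔ τ.Realize (Sum.elim w y)) →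
            (∀ v, v ∈ A ↔ α.Realize (Sum.elim v y')) →
            K < A.card → ∀ t ∈ T, t ∉ E → ∃ a₀ ∈ A, ∃ a ∈ A, a ≠ a₀ ∧ t + a - a₀ ∈ T := by
  intro m n n' τ α
  obtain ⟨K, Q, C₀, h⟩ := noLonelyTranslate_of_facts h71 hWY hCDM m n n' τ α
  refine ⟨K, Q, C₀, fun F _ _ _ hQ y => h F (hQ.trans ?_) y⟩
  -- the characteristic of a finite field is at most its cardinality
  obtain ⟨k, _, hk⟩ := FiniteField.card F (ringChar F)
  rw [hk]
  exact Nat.le_self_pow k.ne_zero _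

end Literature.ModelTheory.PseudofiniteFields
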